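import Summits.SmoothPoincare4.SmoothPoincare4.Theorems.CylinderEntropyCylinderRungTwoFluxIdentityNormalisation
import HarnessLib

/-!
# Flux identity, part 5: the uniform push-off lemma; vertical lines and the lower side

Part of the proof of the stub `stub_fluxIdentity` (the FLUX IDENTITY `|∫_M ν₅ d(ι^*μH⁴)| = μH⁴(S⁴)`
for connected compact cross-sections of `N = S⁴ × ℝ ⊂ ℝ⁶`) of line `killing-flux` of the crux
`CylinderEntropy.CylinderRungTwo` (stmt-SmoothPoincare4-7631); see the final file
`CylinderEntropyCylinderRungTwoFluxIdentity.lean` for the overall argument. Everything here is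
proved (no named facts); theorems only.

* `inner_eq_zero_of_pushoff_seq`, `exists_pushoff_notMem_range` — pushing `ι(M)` off itself along
  a compact family of directions transverse to the cross-section and normalising back onto `N`
  misses `ι(M)` for small `t > 0` (strict differentiability of `ι ∘ φ⁻¹`, injectivity of `dΦ`);
* vertical lines `s ↦ (p, s)`, the predicate "joined in `N ∖ ι(M)` to a point of height `≤ -R`"
  (inline notation `Low`), and their elementary properties.
-/

-- the prescribed namespace `Summit.SmoothPoincare4.SmoothPoincare4.…` repeats `SmoothPoincare4`
set_option linter.dupNamespace false

noncomputable section

open MeasureTheory Set Function Filter Module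
open scoped Manifold ContDiff ENNReal Topology RealInnerProductSpace NNReal

namespace Summit.SmoothPoincare4.SmoothPoincare4.Theorems.CylinderRungTwo.KillingFlux

open Literature.Geometry.Riemannian
open Literature.Geometry.Lorentzian Literature.Geometry.Lorentzian.PseudoRiemannianMetric
open Literature.Geometry.Riemannian.SphericalCylinderEntropy (truncL truncL_apply lipschitz_truncL
  hausdorffMeasure_sphere_four_pos hausdorffMeasure_sphere_four_lt_top)
open Literature.Geometry.Manifold.CylinderSlice (axis castSucc_ne_five)

section Normalisation

variable {M : Type} [TopologicalSpace M] [ChartedSpace (EuclideanSpace ℝ (Fin 4)) M] [IsManifold (𝓡 4) ∞ M]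

/-- **Sequential push-off lemma.** Let `xₙ → x₀` in `M`, directions `τₙ → τ₀` in `ℝ⁶` tangent
to `N` at `ι xₙ`, and `tₙ → 0⁺`. If every pushed-off and normalised point `nrm(ι xₙ + tₙ τₙ)`
lies on `ι(M)`, then the limit direction is tangent to the cross-section: `⟪τ₀, ν x₀⟫ = 0`.
(Proof: the hit points `ι yₙ` converge to `ι x₀`, so `yₙ → x₀`; in the chart at `x₀` the chords
`ι yₙ - ι xₙ = tₙ τₙ + O(tₙ²)` are `dΦ(φ yₙ - φ xₙ) + o(‖φ yₙ - φ xₙ‖)` by strict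
differentiability, `dΦ` is injective with normal `ν x₀`, whence `⟪τₙ, ν x₀⟫ → 0`.) [folklore] -/
theorem inner_eq_zero_of_pushoff_seq {ι ν : M → (EuclideanSpace ℝ (Fin 6))}
    (hι : Manifold.IsSmoothEmbedding (𝓡 4) (𝓡 6) ∞ ι)
    (hιN : ∀ x, ∑ i : Fin 5, ι x (Fin.castSucc i) ^ 2 = 1)
    (hνn : (euclideanMetric (EuclideanSpace ℝ (Fin 6))).IsUnitNormal (𝓡 4) ι ν 1)
    {x : ℕ → M} {x₀ : M} (hx : Tendsto x atTop (𝓝 x₀))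
    {τ : ℕ → (EuclideanSpace ℝ (Fin 6))} {τ₀ : (EuclideanSpace ℝ (Fin 6))} (hτ : Tendsto τ atTop (𝓝 τ₀))
    (hτt : ∀ n, ∑ i : Fin 5, τ n (Fin.castSucc i) * ι (x n) (Fin.castSucc i) = 0)
    {t : ℕ → ℝ} (ht : Tendsto t atTop (𝓝 0)) (ht0 : ∀ n, 0 < t n)
    {y : ℕ → M} (hy : ∀ n, (fun z : EuclideanSpace ℝ (Fin 6) => (‖truncL z‖⁻¹ : ℝ) • (z - z (5 : Fin 6) • (axis :
          EuclideanSpace ℝ (Fin 6))) + z (5 : Fin 6) • (axis : EuclideanSpace ℝ (Fin 6))) (ι (x n) + t n • τ n) = ι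
          (y n)) :
    ⟪τ₀, ν x₀⟫ = 0 := by
  have hιc : Continuous ι := hι.contMDiff.continuous
  -- the pushed-off points `zₙ` converge to `ι x₀`, hence so do the hit points, hence `yₙ → x₀`
  have hz : Tendsto (fun n => ι (x n) + t n • τ n) atTop (𝓝 (ι x₀)) := by
    have := (hιc.tendsto x₀ |>.comp hx).add (ht.smul hτ)
    simpa using this
  have hnrm_at : ContinuousAt (fun z : EuclideanSpace ℝ (Fin 6) => (‖truncL z‖⁻¹ : ℝ) • (z - z (5 : Fin 6) • (axis :
        EuclideanSpace ℝ (Fin 6))) + z (5 : Fin 6) • (axis : EuclideanSpace ℝ (Fin 6))) (ι x₀) := by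
    refine continuousOn_nrm.continuousAt ((isOpen_ne_fun truncL.continuous continuous_const).mem_nhds ?_)
    show truncL (ι x₀) ≠ 0
    rw [← norm_ne_zero_iff, ← Real.sqrt_sq (norm_nonneg _), norm_truncL_sq, hιN, Real.sqrt_one]
    exact one_ne_zero
  have hyι : Tendsto (fun n => ι (y n)) atTop (𝓝 (ι x₀)) := by
    have h1 := hnrm_at.tendsto.comp hz
    have h0 := nrm_eq_self (hιN x₀)
    beta_reduce at h0 h1
    rw [h0] at h1
    refine h1.congr fun n => ?_
    have := hy n
    beta_reduce at this
    exact this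
  have hyx : Tendsto y atTop (𝓝 x₀) := hι.isEmbedding.tendsto_nhds_iff.2 hyι
  -- the chart at `x₀`
  set φ := extChartAt (𝓡 4) x₀ with hφ
  set a₀ : (EuclideanSpace ℝ (Fin 4)) := φ x₀ with ha₀
  have hx₀s : x₀ ∈ φ.source := mem_extChartAt_source x₀
  have ha₀t : a₀ ∈ φ.target := φ.map_source hx₀s
  have hsymm : φ.symm a₀ = x₀ := φ.left_inv hx₀s
  have ha : Tendsto (fun n => φ (x n)) atTop (𝓝 a₀) := (continuousAt_extChartAt x₀).tendsto.comp hx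
  have hb : Tendsto (fun n => φ (y n)) atTop (𝓝 a₀) := (continuousAt_extChartAt x₀).tendsto.comp hyx
  -- strict differentiability of `Φ = ι ∘ φ⁻¹` at `a₀`, with injective differential `A ⊥ ν x₀`
  set A : (EuclideanSpace ℝ (Fin 4)) →L[ℝ] (EuclideanSpace ℝ (Fin 6)) := ((ContinuousLinearMap.comp (mfderiv (𝓡 4)
        (𝓡 6) ι ((extChartAt (𝓡 4) x₀).symm a₀)) (mfderivWithin 𝓘(ℝ, EuclideanSpace ℝ (Fin 4)) (𝓡 4) (extChartAt (𝓡
        4) x₀).symm (Set.range (𝓡 4)) a₀)) : EuclideanSpace ℝ (Fin 4) →L[ℝ] EuclideanSpace ℝ (Fin 6)) with hA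
  have hstrict : HasStrictFDerivAt ((ι ∘ (extChartAt (𝓡 4) x₀).symm)) A a₀ :=
    ((contDiffOn_chartRep hι x₀).contDiffAt ((isOpen_extChartAt_target x₀).mem_nhds ha₀t)).hasStrictFDerivAt'
      (hasFDerivAt_chartRep hι x₀ ha₀t) (by simp)
  have hAinj : Injective A := chartDeriv_injective hι x₀ ha₀t
  obtain ⟨K, hK0, hK⟩ := (A : (EuclideanSpace ℝ (Fin 4)) →ₗ[ℝ] (EuclideanSpace ℝ (Fin
        6))).exists_antilipschitzWith (LinearMap.ker_eq_bot.2 hAinj)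
  have hKd : ∀ d : (EuclideanSpace ℝ (Fin 4)), ‖d‖ ≤ K * ‖A d‖ := fun d => hK.le_mul_norm (map_zero _) d
  have hAν : ∀ d : (EuclideanSpace ℝ (Fin 4)), ⟪A d, ν x₀⟫ = 0 := by
    intro d
    have h := inner_nu_mfderiv hνn (φ.symm a₀)
      ((mfderivWithin 𝓘(ℝ, (EuclideanSpace ℝ (Fin 4))) (𝓡 4) φ.symm (range (𝓡 4)) a₀) d)
    have hνeq : ν (φ.symm a₀) = ν x₀ := by rw [hsymm]
    rw [hνeq] at h
    rw [real_inner_comm]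
    exact h
  -- little-o along the pair sequence
  have hpair : Tendsto (fun n => (φ (y n), φ (x n))) atTop (𝓝 (a₀, a₀)) := hb.prodMk_nhds ha
  have hlo := hstrict.isLittleO.comp_tendsto hpair
  -- suppose the conclusion fails
  by_contra hne
  set δ : ℝ := |⟪τ₀, ν x₀⟫| with hδ
  have hδ0 : 0 < δ := abs_pos.2 hne
  set C : ℝ := ‖τ₀‖ + 1 with hC
  have hC0 : 0 < C := by positivity
  have hK0' : (0 : ℝ) < K := by exact_mod_cast hK0
  set ε : ℝ := δ / (64 * K * C) with hε
  have hε0 : 0 < ε := by positivity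
  -- eventual facts
  have e1 : ∀ᶠ n in atTop, x n ∈ φ.source := hx (isOpen_extChartAt_source x₀ |>.mem_nhds hx₀s)
  have e2 : ∀ᶠ n in atTop, y n ∈ φ.source := hyx (isOpen_extChartAt_source x₀ |>.mem_nhds hx₀s)
  have e3 : ∀ᶠ n in atTop, ‖τ n‖ < C := (hτ.norm).eventually (Iio_mem_nhds (lt_add_one _))
  have e4 : ∀ᶠ n in atTop, t n < min (1 / C) (δ / (8 * C ^ 2)) :=
    ht.eventually (Iio_mem_nhds (lt_min (by positivity) (by positivity)))
  have e5 : ∀ᶠ n in atTop, ‖((ι ∘ (extChartAt (𝓡 4) x₀).symm)) (φ (y n)) - ((ι ∘ (extChartAt (𝓡 4) x₀).symm)) (φ (x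
        n)) - A (φ (y n) - φ (x n))‖ ≤
      ε * ‖φ (y n) - φ (x n)‖ := hlo.def hε0
  have e6 : ∀ᶠ n in atTop, dist ⟪τ n, ν x₀⟫ ⟪τ₀, ν x₀⟫ < δ / 4 :=
    (hτ.inner tendsto_const_nhds).eventually (Metric.ball_mem_nhds _ (by positivity))
  obtain ⟨n, h1, h2, h3, h4, h5, h6⟩ := (e1.and (e2.and (e3.and (e4.and (e5.and e6))))).exists
  -- the chord `w = ι yₙ - ι xₙ`, its chart preimage `d`, and the error `e`
  have hFx : ((ι ∘ (extChartAt (𝓡 4) x₀).symm)) (φ (x n)) = ι (x n) := by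
    show ι (φ.symm (φ (x n))) = ι (x n); rw [φ.left_inv h1]
  have hFy : ((ι ∘ (extChartAt (𝓡 4) x₀).symm)) (φ (y n)) = ι (y n) := by
    show ι (φ.symm (φ (y n))) = ι (y n); rw [φ.left_inv h2]
  rw [hFx, hFy] at h5
  set w : (EuclideanSpace ℝ (Fin 6)) := ι (y n) - ι (x n) with hw
  set d : (EuclideanSpace ℝ (Fin 4)) := φ (y n) - φ (x n) with hd
  set e : (EuclideanSpace ℝ (Fin 6)) := w - A d with he
  clear_value e d w
  have htn := ht0 n
  have ht1 : t n < 1 / C := lt_of_lt_of_le h4 (min_le_left _ _)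
  have ht2 : t n < δ / (8 * C ^ 2) := lt_of_lt_of_le h4 (min_le_right _ _)
  -- `‖w - t τₙ‖ ≤ t² C²`
  have hw1 : ‖w - t n • τ n‖ ≤ t n ^ 2 * C ^ 2 := by
    have := (norm_nrm_sub_le (hιN (x n)) (hτt n) (t n)).2
    have hyn := hy n
    beta_reduce at this hyn
    rw [hyn] at this
    have heq : ι (y n) - (ι (x n) + t n • τ n) = w - t n • τ n := by rw [hw]; abel
    rw [heq] at this
    refine this.trans ?_
    have : ‖τ n‖ ^ 2 ≤ C ^ 2 := by
      have := h3.le; have h0 := norm_nonneg (τ n); nlinarith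
    nlinarith [sq_nonneg (t n)]
  have htC : t n * C ≤ 1 := by
    rw [lt_div_iff₀ hC0] at ht1; linarith
  have hδC : δ ≤ C := by
    rw [hδ]
    refine (abs_real_inner_le_norm _ _).trans ?_
    rw [norm_nu hνn x₀, mul_one, hC]; linarith
  -- `‖d‖ ≤ K (‖w‖ + ε ‖d‖)` and `|⟪w, ν x₀⟫| ≤ ‖e‖ ≤ ε ‖d‖`
  have hdK : ‖d‖ ≤ K * (‖w‖ + ε * ‖d‖) := by
    have hAd : ‖A d‖ ≤ ‖w‖ + ‖e‖ := by
      have : A d = w - e := by rw [he]; abel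
      rw [this]; exact norm_sub_le _ _
    calc ‖d‖ ≤ K * ‖A d‖ := hKd d
      _ ≤ K * (‖w‖ + ‖e‖) := by gcongr
      _ ≤ K * (‖w‖ + ε * ‖d‖) := by gcongr
  have hwν : |⟪w, ν x₀⟫| ≤ ε * ‖d‖ := by
    have : ⟪w, ν x₀⟫ = ⟪e, ν x₀⟫ := by
      rw [he, inner_sub_left, hAν d, sub_zero]
    rw [this]
    refine (abs_real_inner_le_norm _ _).trans ?_
    rw [norm_nu hνn x₀, mul_one]
    exact h5
  have ht2' : t n * C ^ 2 < δ / 8 := by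
    rw [lt_div_iff₀ (by positivity)] at ht2; linarith
  have hend := pushoff_endgame htn hC0 hK0' hδ0 hδC hε (norm_nu hνn x₀) hw1 h3.le htC
    (norm_nonneg d) hdK hwν ht2'
  -- but `|⟪τₙ, ν x₀⟫| > 3δ/4`
  rw [Real.dist_eq] at h6
  have := abs_sub_abs_le_abs_sub ⟪τ₀, ν x₀⟫ ⟪τ n, ν x₀⟫
  rw [abs_sub_comm] at this
  rw [hδ] at hend h6
  linarith

/-- **Uniform push-off lemma.** For a compact family `p ↦ (f p, g p)` of points of `M` and
directions tangent to `N` and transverse to the cross-section (`⟪g p, ν (f p)⟫ ≠ 0`), there is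
`t₀ > 0` such that no pushed-off and normalised point `nrm(ι (f p) + t g p)`, `0 < t ≤ t₀`, lies on
`ι(M)` (compactness + `inner_eq_zero_of_pushoff_seq`). [folklore] -/
theorem exists_pushoff_notMem_range {ι ν : M → (EuclideanSpace ℝ (Fin 6))}
    (hι : Manifold.IsSmoothEmbedding (𝓡 4) (𝓡 6) ∞ ι)
    (hιN : ∀ x, ∑ i : Fin 5, ι x (Fin.castSucc i) ^ 2 = 1)
    (hνn : (euclideanMetric (EuclideanSpace ℝ (Fin 6))).IsUnitNormal (𝓡 4) ι ν 1)
    {P : Type} [TopologicalSpace P] [CompactSpace P] [FirstCountableTopology P]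
    {f : P → M} (hf : Continuous f) {g : P → (EuclideanSpace ℝ (Fin 6))} (hg : Continuous g)
    (hgt : ∀ p, ∑ i : Fin 5, g p (Fin.castSucc i) * ι (f p) (Fin.castSucc i) = 0)
    (hgν : ∀ p, ⟪g p, ν (f p)⟫ ≠ 0) :
    ∃ t₀ : ℝ, 0 < t₀ ∧ ∀ p, ∀ t ∈ Ioc (0 : ℝ) t₀, (fun z : EuclideanSpace ℝ (Fin 6) => (‖truncL z‖⁻¹ : ℝ) • (z - z
          (5 : Fin 6) • (axis : EuclideanSpace ℝ (Fin 6))) + z (5 : Fin 6) • (axis : EuclideanSpace ℝ (Fin 6))) (ι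
          (f p) + t • g p) ∉ range ι := by
  by_contra H
  push Not at H
  -- a bad sequence with `tₙ ≤ 1/(n+1)`
  have hbad : ∀ n : ℕ, ∃ p : P, ∃ t : ℝ, t ∈ Ioc (0 : ℝ) (1 / ((n : ℝ) + 1)) ∧
      (fun z : EuclideanSpace ℝ (Fin 6) => (‖truncL z‖⁻¹ : ℝ) • (z - z (5 : Fin 6) • (axis : EuclideanSpace ℝ (Fin
            6))) + z (5 : Fin 6) • (axis : EuclideanSpace ℝ (Fin 6))) (ι (f p) + t • g
            p) ∈ range ι := fun n => H _ (by positivity)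
  choose p t htI hmem using hbad
  choose y hy using hmem
  -- extract a convergent subsequence of parameters
  obtain ⟨p₀, -, φ, hφ, hpφ⟩ := isCompact_univ.tendsto_subseq (x := p) fun n => mem_univ _
  have ht0 : ∀ n, 0 < t (φ n) := fun n => (htI (φ n)).1
  have htlim : Tendsto (fun n => t (φ n)) atTop (𝓝 0) := by
    refine tendsto_of_tendsto_of_tendsto_of_le_of_le tendsto_const_nhds
      tendsto_one_div_add_atTop_nhds_zero_nat (fun n => (ht0 n).le) fun n => ?_
    refine (htI (φ n)).2.trans ?_
    have : (n : ℝ) ≤ φ n := by exact_mod_cast hφ.id_le n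
    gcongr
  have key := inner_eq_zero_of_pushoff_seq hι hιN hνn (hf.tendsto p₀ |>.comp hpφ)
    (hg.tendsto p₀ |>.comp hpφ) (fun n => hgt (p (φ n))) htlim ht0 (y := fun n => y (φ n))
    (fun n => (hy (φ n)).symm)
  exact hgν p₀ key

/-! ## §6 Sides of the cross-section and crossings of vertical lines -/

section Sides

open Literature.Geometry.Manifold.CylinderSlice (padL padL_apply_castSucc padL_apply_last)

/-! ### Vertical lines `s ↦ (p, s)` -/

/-- Coordinates of the point `(p, s)` of the vertical line over `p`. [folklore] -/
theorem vert_apply_castSucc (p : (EuclideanSpace ℝ (Fin 5))) (s : ℝ) (i : Fin 5) :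
    (padL p + s • (axis : (EuclideanSpace ℝ (Fin 6)))) (Fin.castSucc i) = p i := by
  simp [axis, castSucc_ne_five i]

/-- Height of the point `(p, s)`. [folklore] -/
theorem vert_apply_five (p : (EuclideanSpace ℝ (Fin 5))) (s : ℝ) : (padL p + s • (axis : (EuclideanSpace ℝ (Fin
      6)))) 5 = s := by
  simp [axis]

/-- Every `z ∈ ℝ⁶` is `(z', z₅)`. [folklore] -/
theorem eq_vert (z : (EuclideanSpace ℝ (Fin 6))) : z = padL (truncL z) + z 5 • (axis : (EuclideanSpace ℝ (Fin
      6))) := by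
  ext j
  induction j using Fin.lastCases with
  | last => rw [show (Fin.last 5 : Fin 6) = 5 from rfl, vert_apply_five]
  | cast i => rw [vert_apply_castSucc, truncL_apply]

/-- `truncL (p, s) = p`. [folklore] -/
theorem truncL_vert (p : (EuclideanSpace ℝ (Fin 5))) (s : ℝ) : truncL (padL p + s • (axis : (EuclideanSpace ℝ (Fin
      6)))) = p := by
  ext i; rw [truncL_apply, vert_apply_castSucc]

/-- Points of vertical lines over the unit sphere lie in `N`. [folklore] -/
theorem vert_mem_Ncyl {p : (EuclideanSpace ℝ (Fin 5))} (hp : ∑ i : Fin 5, p i ^ 2 = 1) (s : ℝ) :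
    padL p + s • (axis : (EuclideanSpace ℝ (Fin 6))) ∈ ({z : EuclideanSpace ℝ (Fin 6) | ∑ i : Fin 5, z (Fin.castSucc
          i) ^ 2 = 1} : Set (EuclideanSpace ℝ (Fin 6))) := by
  show ∑ i : Fin 5, (padL p + s • (axis : (EuclideanSpace ℝ (Fin 6)))) (Fin.castSucc i) ^ 2 = 1
  simp only [vert_apply_castSucc, hp]

variable {M : Type}

/-- `(p, s) ∈ ι(M)` iff some point of the fibre of the shadow over `p` has height `s`. [folklore] -/
theorem vert_mem_range_iff (ι : M → (EuclideanSpace ℝ (Fin 6))) (p : (EuclideanSpace ℝ (Fin 5))) (s : ℝ) :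
    padL p + s • (axis : (EuclideanSpace ℝ (Fin 6))) ∈ range ι ↔ ∃ x, truncL (ι x) = p ∧ ι x 5 = s := by
  constructor
  · rintro ⟨x, hx⟩
    exact ⟨x, by rw [hx, truncL_vert], by rw [hx, vert_apply_five]⟩
  · rintro ⟨x, hxp, hxs⟩
    exact ⟨x, by rw [eq_vert (ι x), hxp, hxs]⟩

/-- A vertical segment missing `ι(M)` joins its endpoints in `N ∖ ι(M)`. [folklore] -/
theorem joinedIn_vert {ι : M → (EuclideanSpace ℝ (Fin 6))} {p : (EuclideanSpace ℝ (Fin 5))} (hp : ∑ i : Fin 5, p i ^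
      2 = 1) {s₀ s₁ : ℝ}
    (h : ∀ s ∈ Set.uIcc s₀ s₁, padL p + s • (axis : (EuclideanSpace ℝ (Fin 6))) ∉ range ι) :
    JoinedIn (({z : EuclideanSpace ℝ (Fin 6) | ∑ i : Fin 5, z (Fin.castSucc i) ^ 2 = 1} : Set (EuclideanSpace ℝ (Fin
          6))) \ range ι) (padL p + s₀ • (axis : (EuclideanSpace ℝ (Fin 6)))) (padL p + s₁ • (axis : (EuclideanSpace
          ℝ (Fin 6)))) := by
  refine JoinedIn.of_segment_subset ?_
  rintro w ⟨a, b, ha, hb, hab, rfl⟩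
  have hw : a • (padL p + s₀ • (axis : (EuclideanSpace ℝ (Fin 6)))) + b • (padL p + s₁ • (axis : (EuclideanSpace ℝ
        (Fin 6)))) =
      padL p + (a * s₀ + b * s₁) • (axis : (EuclideanSpace ℝ (Fin 6))) := by
    calc a • (padL p + s₀ • (axis : (EuclideanSpace ℝ (Fin 6)))) + b • (padL p + s₁ • (axis : (EuclideanSpace ℝ (Fin
          6))))
        = (a + b) • padL p + (a * s₀ + b * s₁) • (axis : (EuclideanSpace ℝ (Fin 6))) := by
          simp only [smul_add, smul_smul, add_smul]; abel
      _ = padL p + (a * s₀ + b * s₁) • (axis : (EuclideanSpace ℝ (Fin 6))) := by rw [hab, one_smul]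
  rw [hw]
  -- `a s₀ + b s₁ ∈ [s₀, s₁]`
  have hmem : a * s₀ + b * s₁ ∈ Set.uIcc s₀ s₁ := by
    rw [← segment_eq_uIcc]; exact ⟨a, b, ha, hb, hab, rfl⟩
  exact ⟨vert_mem_Ncyl hp _, h _ hmem⟩

/-! ### The lower side -/

/-- A point of `N ∖ ι(M)` of height `≤ -R` is on the lower side. [folklore] -/
theorem low_of_le {ι : M → (EuclideanSpace ℝ (Fin 6))} {R : ℝ} {z : (EuclideanSpace ℝ (Fin 6))} (hz : z ∈ ({z :
      EuclideanSpace ℝ (Fin 6) | ∑ i : Fin 5, z (Fin.castSucc i) ^ 2 = 1} : Set (EuclideanSpace ℝ (Fin 6))) \ range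
      ι) (h5 : z 5 ≤ -R) :
    (∃ b : EuclideanSpace ℝ (Fin 6), (∑ i : Fin 5, b (Fin.castSucc i) ^ 2 = 1) ∧ b (5 : Fin 6) ≤ -R ∧ JoinedIn (({z
          : EuclideanSpace ℝ (Fin 6) | ∑ i : Fin 5, z (Fin.castSucc i) ^ 2 = 1} : Set (EuclideanSpace ℝ (Fin 6))) \
          Set.range ι) z b) :=
  ⟨z, hz.1, h5, JoinedIn.refl hz⟩

/-- Under the separation hypothesis, no point of `N` of height `≥ R` is on the lower side.
[folklore] -/
theorem not_low_of_ge {ι : M → (EuclideanSpace ℝ (Fin 6))} {R : ℝ}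
    (hsep : ∀ a b : (EuclideanSpace ℝ (Fin 6)), ∑ i : Fin 5, a (Fin.castSucc i) ^ 2 = 1 →
      ∑ i : Fin 5, b (Fin.castSucc i) ^ 2 = 1 → a 5 ≤ -R → R ≤ b 5 → ¬ JoinedIn (({z : EuclideanSpace ℝ (Fin 6) | ∑
            i : Fin 5, z (Fin.castSucc i) ^ 2 = 1} : Set (EuclideanSpace ℝ (Fin 6))) \ range ι) a b)
    {z : (EuclideanSpace ℝ (Fin 6))} (hz : ∑ i : Fin 5, z (Fin.castSucc i) ^ 2 = 1) (h5 : R ≤ z 5) : ¬ (∃ b :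
          EuclideanSpace ℝ (Fin 6), (∑ i : Fin 5, b (Fin.castSucc i) ^ 2 = 1) ∧ b (5 : Fin 6) ≤ -R ∧ JoinedIn (({z :
          EuclideanSpace ℝ (Fin 6) | ∑ i : Fin 5, z (Fin.castSucc i) ^ 2 = 1} : Set (EuclideanSpace ℝ (Fin 6))) \
          Set.range ι) z b) := by
  rintro ⟨b, hb, hb5, hj⟩
  exact hsep b z hb hz hb5 h5 hj.symm

/-- Joined points are on the same side. [folklore] -/
theorem low_iff_of_joinedIn {ι : M → (EuclideanSpace ℝ (Fin 6))} {R : ℝ} {z z' : (EuclideanSpace ℝ (Fin 6))} (h :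
      JoinedIn (({z : EuclideanSpace ℝ (Fin 6) | ∑ i : Fin 5, z (Fin.castSucc i) ^ 2 = 1} : Set (EuclideanSpace ℝ
      (Fin 6))) \ range ι) z z') :
    (∃ b : EuclideanSpace ℝ (Fin 6), (∑ i : Fin 5, b (Fin.castSucc i) ^ 2 = 1) ∧ b (5 : Fin 6) ≤ -R ∧ JoinedIn (({z
          : EuclideanSpace ℝ (Fin 6) | ∑ i : Fin 5, z (Fin.castSucc i) ^ 2 = 1} : Set (EuclideanSpace ℝ (Fin 6))) \
          Set.range ι) z b) ↔ (∃ b : EuclideanSpace ℝ (Fin 6), (∑ i : Fin 5, b (Fin.castSucc i) ^ 2 = 1) ∧ b (5 :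
          Fin 6) ≤ -R ∧ JoinedIn (({z : EuclideanSpace ℝ (Fin 6) | ∑ i : Fin 5, z (Fin.castSucc i) ^ 2 = 1} : Set
          (EuclideanSpace ℝ (Fin 6))) \ Set.range ι) z' b) :=
  ⟨fun ⟨b, hb, hb5, hj⟩ => ⟨b, hb, hb5, h.symm.trans hj⟩, fun ⟨b, hb, hb5, hj⟩ => ⟨b, hb, hb5, h.trans hj⟩⟩

/-- A pushed-off point lands in `N` after normalisation, and (by the push-off lemma) off `ι(M)`:
membership in `N ∖ ι(M)`. [folklore] -/
theorem nrm_pushoff_mem {ι : M → (EuclideanSpace ℝ (Fin 6))} (hιN : ∀ x, ∑ i : Fin 5, ι x (Fin.castSucc i) ^ 2 = 1)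
    {x : M} {τ : (EuclideanSpace ℝ (Fin 6))} (hτ : ∑ i : Fin 5, τ (Fin.castSucc i) * ι x (Fin.castSucc i) = 0) {t :
          ℝ}
    (h : (fun z : EuclideanSpace ℝ (Fin 6) => (‖truncL z‖⁻¹ : ℝ) • (z - z (5 : Fin 6) • (axis : EuclideanSpace ℝ
          (Fin 6))) + z (5 : Fin 6) • (axis : EuclideanSpace ℝ (Fin 6))) (ι x + t • τ) ∉ range ι) : (fun z :
          EuclideanSpace ℝ (Fin 6) => (‖truncL z‖⁻¹ : ℝ) • (z - z (5 : Fin 6) • (axis : EuclideanSpace ℝ (Fin 6))) +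
          z (5 : Fin 6) • (axis : EuclideanSpace ℝ (Fin 6))) (ι x + t • τ) ∈ ({z : EuclideanSpace ℝ (Fin 6) | ∑ i :
          Fin 5, z (Fin.castSucc i) ^ 2 = 1} : Set (EuclideanSpace ℝ (Fin 6))) \ range ι :=
  ⟨sum_sq_nrm (norm_nrm_sub_le (hιN x) hτ t).1, h⟩

end Sides

end Normalisation

/-- Marker of part 5 (registered sub-goal `stub_fluxIdentity_part5`): a point `(p, s)` of a
vertical line lies on `ι(M)` iff a fibre point of the shadow over `p` has height `s`
(`vert_mem_range_iff`). [folklore] -/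
theorem stub_fluxIdentity_part5 :
    ∀ (M : Type) (ι : M → EuclideanSpace ℝ (Fin 6)) (p : EuclideanSpace ℝ (Fin 5)) (s : ℝ),
      Literature.Geometry.Manifold.CylinderSlice.padL p + s •
      Literature.Geometry.Manifold.CylinderSlice.axis ∈ Set.range ι ↔ ∃ x,
      Literature.Geometry.Riemannian.SphericalCylinderEntropy.truncL (ι x) = p ∧ ι x 5 = s :=
  fun _ ι p s => vert_mem_range_iff ι p s

end Summit.SmoothPoincare4.SmoothPoincare4.Theorems.CylinderRungTwo.KillingFlux
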